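/-
Copyright: the b2b-balaban T⁴-continuum CRUX team, row NE7b leaf lineage `t4-ne7b-formalise-leaf-06` (gen 162). Project licence.
-/
import Summits.QuantumFields.BalabanUV.T4Continuum.Spine.NE7b.SupEquationTowerStep
import Summits.QuantumFields.BalabanUV.T4Continuum.Spine.NE7b.SupResponseSecondCurrency

/-!
# THE RE-ENTRANT STEP WITH A SECOND CURRENCY: `…SupEquationTowerStep.towerStep`'s state at level `k` augmented by per-level
# SEMINORMS `p_k` on `X k`, `q_k` on `K k` and the linearisation's second-currency bound `B^w_k` and modulus `M^w_k`
# (displacement in the first currency); the defect SRSC consumes is again modulus × radius, `c^w_k := C^w_{P_k} M^w_k r_k`, so with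
# `N^w_k c^w_k < 1` the branch carries SRSC's letters (W1)–(W3) at level `k` AND the next equation map `Q_k∘Eq∘σ_k` satisfies the
# second-currency state at level `k+1` with `B^w_{k+1} ≥ C^w_{Q_k} B^w_k K^w_k`, `M^w_{k+1} ≥ C^w_{Q_k}(M^w_k K₁ K^w_k + B^w_k K^w_k C^w_{P_k} M^w_k K₁ K^w_k)`
# — the second-currency state RE-ENTERS (row NE7b, node U5c; STEP + SRSC BY NAME; [folklore]; any Banach currencies, any seminorms)

Cell `pub-balaban`, sub-cell `t4`, spine estimate NE7b (`T4WeightBudget.RelWeightBound`; the cell's OWN estimate — NOT PRINTED in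
[Bałaban 1983–89], NOT PROVED).  Crux-route work under `Spine/NE7b/` by a row leaf (`t4-ne7b-formalise-leaf-06` gen 162) under FREEZE
(0)'s crux-prover clause (the OWNER g115's ι-3 answer «the per-level letters in SET's currency … whoever takes it says so in one line» —
taken [NE7bLEAF06-G162-ONLINE]; W-ne7bp1-g116-1 (b) GO on SRSC).  NOTHING of Bałaban's is named as a Lean object, valued or asserted;
no `T4Continuum/Support` leaf typed; no `def`; zero `sorry`.  Imports: this lineage's `…SupEquationTowerStep` (STEP) and
`…SupResponseSecondCurrency` (SRSC; through it SIS and `Mathlib.Analysis.Seminorm`).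

WHY (located).  STEP's invariant is first-currency only: `Eq` is `C¹` on `closedBall 0 r_k` with letters `(B_k, M_k)`, `Eq′(0)` the
transported linearisation on an admissible section.  SECS added the second currency AT THE ORIGIN (no smallness), SRSC OFF the origin
for ONE step (the bootstrap `K^w = N^w∕(1 − N^w c^w)`).  For the tower the second-currency state must RE-ENTER exactly as the first does:
the hypothesis on user data is a seminorm letter for every chart, `p_k(T_k⁻¹(y₁, y₂)) ≤ N^w_k(p_{k+1} y₁ + q_k y₂)` (in the model: the
OWNER's (62) `weighted_augInverse` at every side, for every admissible weight), seminorm letters for `Q_k` and `P_k` (`C^w_{Q_k}`,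
`C^w_{P_k}`; block averaging is neutral on weighted sup spaces, (62) `weighted_blockAvg`), and the state carries `p_k(Eq′ x u) ≤ B^w_k p_k u`,
`p_k((Eq′ x − Eq′ x′)u) ≤ M^w_k‖x − x′‖p_k u` on `closedBall 0 r_k`.  Since the chart inverts the TRUE linearisation `Eq′(0)`, SRSC's
defect letter is `q_k(P_k((Eq′ 0 − Eq′ x)u)) ≤ C^w_{P_k} M^w_k ‖x‖ p_k u ≤ C^w_{P_k} M^w_k r_k p_k u` (§1) — modulus × radius, the
second-currency copy of STEP's `norm_comp_sub_le_of_modulus_closedBall`; and SRSC (W4)∕(W5) on `ball 0 ρ_k ⊇ closedBall 0 r_{k+1}` are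
the next state's `B^w`∕`M^w` letters under the two displayed recursion inequalities.  HONEST BOOKKEEPING: as in STEP nothing is small
by itself (`K^w_k ≥ N^w_k`; the second-currency moduli grow like the first); the recursions are DISPLAYED, their control in the model is
the OWNER's one-shot ∕ semigroup identification (SOS; C-ne7bp1-g116-2 `SupBackgroundSemigroup`), not here.

WHAT IS PROVED ([folklore]; `X, K : ℕ → Type`, every `X k` a nontrivial real Banach space, every `K k` real normed; `p_k`, `q_k` seminorms):
* §1 `seminorm_defect_le_of_modulus_closedBall` (`q(P((Y 0 − Y x)u)) ≤ C^w_P·M^w·r·p u` on `closedBall 0 r` from `q∘P ≤ C^w_P p` and the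
  second-currency modulus).
* §2 **`towerStep_weighted`** — `towerStep`'s data and level-`k` state VERBATIM ⟹ `∃ σ` with `towerStep`'s conclusions VERBATIM
  (branch (a), Lipschitz, uniqueness, (b), (d), and the next FIRST-currency state), AND — quantified AFTER `σ` (one branch for all
  admissible weights; the OWNER's rider (i) on SECS) — for every choice of seminorm families `p, q`, nonnegative `N^w, B^w, M^w, C^w_P,
  C^w_Q : ℕ → ℝ` and `c^w` with `C^w_{P_k} M^w_k r_k ≤ c^w_k`, `N^w_k c^w_k < 1`, the charts' seminorm letters, `Q_k`'s and `P_k`'s seminorm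
  letters, the two second-currency recursion inequalities, and the level-`k` second-currency state: (W1) the fibre letter at every
  background `w ∈ closedBall 0 ρ_k` (`Q_k u = 0 → p_k u ≤ K^w_k q_k(P_k(Eq′(σ w)u))`), (W2) the response letter and (W3) its two-point
  modulus on `ball 0 ρ_k`, and THE NEXT SECOND-CURRENCY STATE on `closedBall 0 r_{k+1}`:
  `p_{k+1}((Q_k∘Eq′(σ w)∘Dσ(w)) v) ≤ B^w_{k+1} p_{k+1} v`, `p_{k+1}((Q_k∘Eq′(σ w)∘Dσ(w) − Q_k∘Eq′(σ w′)∘Dσ(w′)) v) ≤ M^w_{k+1}‖w − w′‖p_{k+1} v`.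
* §3 toy (`example`).

NOT HERE (honest): the recursion over ℕ (sibling `…SupEquationTowerWeighted`, next); the `ℓ^∞(ℤ^d)` instance; seminorm letters BY
VALUE; any control of the recursions; (A3) ∕ (A1c); NC-NE7b-α UNRULED; anything of Bałaban's.  BY-NAME EFFECT ON THE WALL: NONE.
NE7b NOT PRINTED ∕ NOT PROVED; spine PROVED 0∕9; rung (B)+1 on a FINITE torus — NOT infinite volume, NOT the mass gap, NOT Clay.
HONEST DEPENDENCY: continuum YM on T⁴ ⇐ BetaPertH ∧ nine spine estimates (0∕9 proved); BetaPertH ⇐ (D1) ∧ (D4) ∧ CAP+tail;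
G-an2-4 gates asym, D1 and NE2∕3∕4.
-/

set_option autoImplicit false

noncomputable section

namespace Summit.QuantumFields.BalabanUV.T4Continuum.NE7b.SupEquationTowerStepWeighted

open Set Metric Function
open scoped NNReal
open Summit.QuantumFields.BalabanUV.T4Continuum.NE7b

/-! ## §1. The second-currency defect from the modulus on a closed ball -/

section Letters

variable {E G : Type*} [NormedAddCommGroup E] [NormedSpace ℝ E] [NormedAddCommGroup G] [NormedSpace ℝ G]

/-- The second-currency smallness letter from the modulus on a CLOSED ball: `q(P h) ≤ C^w_P p h`,
`p((Y x − Y x′)u) ≤ M^w‖x − x′‖p u` on `closedBall 0 r`, `0 ≤ C^w_P`, `0 ≤ M^w` give `q(P((Y 0 − Y x)u)) ≤ C^w_P·M^w·r·p u` there. [folklore] -/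
theorem seminorm_defect_le_of_modulus_closedBall {Y : E → E →L[ℝ] E} {r Mw CPw : ℝ} (P : E →L[ℝ] G)
    (p : Seminorm ℝ E) (q : Seminorm ℝ G) (hCPw0 : 0 ≤ CPw) (hMw0 : 0 ≤ Mw)
    (hCPw : ∀ h, q (P h) ≤ CPw * p h)
    (hY : ∀ x ∈ closedBall (0 : E) r, ∀ x' ∈ closedBall (0 : E) r, ∀ u, p ((Y x - Y x') u) ≤ Mw * ‖x - x'‖ * p u)
    {x : E} (hx : x ∈ closedBall (0 : E) r) (u : E) : q (P ((Y 0 - Y x) u)) ≤ CPw * Mw * r * p u := by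
  have hr : 0 ≤ r := le_trans dist_nonneg (mem_closedBall.1 hx)
  have h0 : (0 : E) ∈ closedBall (0 : E) r := mem_closedBall_self hr
  have hxn : ‖(0 : E) - x‖ ≤ r := by rw [zero_sub, norm_neg]; rwa [mem_closedBall, dist_zero_right] at hx
  calc q (P ((Y 0 - Y x) u)) ≤ CPw * p ((Y 0 - Y x) u) := hCPw _
    _ ≤ CPw * (Mw * ‖(0 : E) - x‖ * p u) := mul_le_mul_of_nonneg_left (hY 0 h0 x hx u) hCPw0
    _ ≤ CPw * (Mw * r * p u) := by
        refine mul_le_mul_of_nonneg_left (mul_le_mul_of_nonneg_right ?_ (apply_nonneg _ _)) hCPw0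
        exact mul_le_mul_of_nonneg_left hxn hMw0
    _ = CPw * Mw * r * p u := by ring

end Letters

/-! ## §2. THE RE-ENTRANT STEP WITH A SECOND CURRENCY -/

variable {X : ℕ → Type*} {K : ℕ → Type*} [∀ k, NormedAddCommGroup (X k)] [∀ k, NormedSpace ℝ (X k)]
  [∀ k, NormedAddCommGroup (K k)] [∀ k, NormedSpace ℝ (K k)]

/-- **THE EQUATION-MAP TOWER's RE-ENTRANT STEP WITH A SECOND CURRENCY.**  `…SupEquationTowerStep.towerStep`'s data and level-`k`
state verbatim ⟹ the branch `σ_k` with STEP's letters and next first-currency state VERBATIM, AND — quantified AFTER `σ_k`, one branch for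
all admissible weights — for every choice of per-level seminorms `p_k` on `X k`, `q_k` on `K k`, nonnegative constants `N^w, B^w, M^w,
C^w_P, C^w_Q` and `c^w` with `C^w_{P_k} M^w_k r_k ≤ c^w_k`, `N^w_k c^w_k < 1`, charts' seminorm letters `p_k(T_k⁻¹(y₁, y₂)) ≤ N^w_k(p_{k+1} y₁ + q_k y₂)`,
blockings' letters `q_k(P_k h) ≤ C^w_{P_k} p_k h`, `p_{k+1}(Q_k h) ≤ C^w_{Q_k} p_k h`, recursions `C^w_{Q_k} B^w_k K^w_k ≤ B^w_{k+1}`,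
`C^w_{Q_k}(M^w_k K₁ K^w_k + B^w_k(K^w_k C^w_{P_k} M^w_k K₁ K^w_k)) ≤ M^w_{k+1}` (`K^w_k = N^w_k∕(1 − N^w_k c^w_k)`, `K₁ = (N_k⁻¹ − c_k)⁻¹`) and the
level-`k` second-currency state (`p_k(Eq′ x u) ≤ B^w_k p_k u`, `p_k((Eq′ x − Eq′ x′)u) ≤ M^w_k‖x − x′‖p_k u` on `closedBall 0 r_k`): SRSC's
(W1)–(W3) at level `k` and the next second-currency state at level `k+1`. [folklore] -/
theorem towerStep_weighted [∀ k, CompleteSpace (X k)] [∀ k, Nontrivial (X k)]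
    (Q : ∀ k, X k →L[ℝ] X (k + 1)) (Lp : ∀ k, X (k + 1) →L[ℝ] X k) (P : ∀ k, X k →L[ℝ] K k) (ι : ∀ k, K k →L[ℝ] X k)
    (hPι : ∀ k h, ι k (P k h) = h - Lp k (Q k h)) {CP : ℕ → ℝ} (hCP : ∀ k, ‖P k‖ ≤ CP k)
    (𝒬 : ∀ k, X 0 →L[ℝ] X k) (h𝒬 : ∀ k, 𝒬 (k + 1) = (Q k).comp (𝒬 k)) (A₀ : X 0 →L[ℝ] X 0)
    {r B M : ℕ → ℝ} (hr0 : ∀ k, 0 ≤ r k) (hM0 : ∀ k, 0 ≤ M k)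
    (T : ∀ k, X k ≃L[ℝ] X (k + 1) × K k) {N c : ℕ → ℝ≥0}
    (hT : ∀ k (𝒮 : X k →L[ℝ] X 0), (𝒬 k).comp 𝒮 = ContinuousLinearMap.id ℝ (X k) →
      (∀ j, j < k → ∀ h, P j (𝒬 j (A₀ (𝒮 h))) = 0) → ∀ h, T k h = (Q k h, P k (𝒬 k (A₀ (𝒮 h)))))
    (hN : ∀ k (y : X (k + 1) × K k), ‖(T k).symm y‖ ≤ N k * ‖y‖) (hcN : ∀ k, c k < (N k)⁻¹)
    (hc : ∀ k, CP k * M k * r k ≤ (c k : ℝ)) (hr : ∀ k, r (k + 1) < ((N k : ℝ)⁻¹ - c k) * r k)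
    (hBs : ∀ k, ‖Q k‖ * B k * ((N k : ℝ)⁻¹ - c k)⁻¹ ≤ B (k + 1))
    (hMs : ∀ k, ‖Q k‖ * (M k * ((N k : ℝ)⁻¹ - c k)⁻¹ * ((N k : ℝ)⁻¹ - c k)⁻¹ +
      B k * ((((N k : ℝ)⁻¹ - c k)⁻¹) ^ 2 * (CP k * M k) * ((N k : ℝ)⁻¹ - c k)⁻¹)) ≤ M (k + 1))
    -- the state at level `k`
    (k : ℕ) {Eq : X k → X k} {Eq' : X k → X k →L[ℝ] X k} {𝒮 : X k →L[ℝ] X 0}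
    (hE0 : Eq 0 = 0) (hE : ∀ x ∈ closedBall (0 : X k) (r k), HasFDerivAt Eq (Eq' x) x)
    (hB : ∀ x ∈ closedBall (0 : X k) (r k), ‖Eq' x‖ ≤ B k)
    (hM : ∀ x ∈ closedBall (0 : X k) (r k), ∀ x' ∈ closedBall (0 : X k) (r k), ‖Eq' x - Eq' x'‖ ≤ M k * ‖x - x'‖)
    (h𝒮 : (𝒬 k).comp 𝒮 = ContinuousLinearMap.id ℝ (X k))
    (hadm : ∀ j, j < k → ∀ h, P j (𝒬 j (A₀ (𝒮 h))) = 0)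
    (hlin : Eq' 0 = (𝒬 k).comp (A₀.comp 𝒮)) :
    ∃ σ : X (k + 1) → X k, σ 0 = 0 ∧
      -- (a) the branch on the closed chart ball
      (∀ w ∈ closedBall (0 : X (k + 1)) (((N k : ℝ)⁻¹ - c k) * r k),
        σ w ∈ closedBall (0 : X k) (r k) ∧ Q k (σ w) = w ∧ P k (Eq (σ w)) = 0 ∧ Eq (σ w) = Lp k (Q k (Eq (σ w)))) ∧
      LipschitzOnWith ((N k)⁻¹ - c k)⁻¹ σ (closedBall (0 : X (k + 1)) (((N k : ℝ)⁻¹ - c k) * r k)) ∧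
      (∀ x ∈ closedBall (0 : X k) (r k), P k (Eq x) = 0 → σ (Q k x) = x) ∧
      -- (b) the derivative letters on the open chart ball
      (∀ w ∈ ball (0 : X (k + 1)) (((N k : ℝ)⁻¹ - c k) * r k), DifferentiableAt ℝ σ w ∧
        ‖fderiv ℝ σ w‖ ≤ ((N k : ℝ)⁻¹ - c k)⁻¹ ∧ (Q k).comp (fderiv ℝ σ w) = ContinuousLinearMap.id ℝ (X (k + 1))) ∧
      -- (d) zeros of the next equation lift
      (∀ w ∈ closedBall (0 : X (k + 1)) (((N k : ℝ)⁻¹ - c k) * r k), Q k (Eq (σ w)) = 0 → Eq (σ w) = 0) ∧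
      -- THE NEXT STATE at level `k + 1` (first currency, as in STEP)
      Q k (Eq (σ 0)) = 0 ∧
      (∀ w ∈ closedBall (0 : X (k + 1)) (r (k + 1)),
        HasFDerivAt (fun w => Q k (Eq (σ w))) ((Q k).comp ((Eq' (σ w)).comp (fderiv ℝ σ w))) w) ∧
      (∀ w ∈ closedBall (0 : X (k + 1)) (r (k + 1)), ‖(Q k).comp ((Eq' (σ w)).comp (fderiv ℝ σ w))‖ ≤ B (k + 1)) ∧
      (∀ w ∈ closedBall (0 : X (k + 1)) (r (k + 1)), ∀ w' ∈ closedBall (0 : X (k + 1)) (r (k + 1)),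
        ‖(Q k).comp ((Eq' (σ w)).comp (fderiv ℝ σ w)) - (Q k).comp ((Eq' (σ w')).comp (fderiv ℝ σ w'))‖ ≤
          M (k + 1) * ‖w - w'‖) ∧
      (𝒬 (k + 1)).comp (𝒮.comp (fderiv ℝ σ 0)) = ContinuousLinearMap.id ℝ (X (k + 1)) ∧
      (∀ j, j < k + 1 → ∀ h, P j (𝒬 j (A₀ ((𝒮.comp (fderiv ℝ σ 0)) h))) = 0) ∧
      (Q k).comp ((Eq' (σ 0)).comp (fderiv ℝ σ 0)) = (𝒬 (k + 1)).comp (A₀.comp (𝒮.comp (fderiv ℝ σ 0))) ∧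
      -- THE SECOND CURRENCY — for EVERY choice of per-level seminorm families, letters, recursions and level-`k` second-currency
      -- state, chosen AFTER `σ` (one branch for all admissible weights): (W1) (W2) (W3) at level `k` and THE NEXT SECOND-CURRENCY STATE
      (∀ (p : ∀ j, Seminorm ℝ (X j)) (q : ∀ j, Seminorm ℝ (K j)) (Nw cw Bw Mw CPw CQw : ℕ → ℝ),
        (∀ j, 0 ≤ Nw j) → (∀ j, 0 ≤ Bw j) → (∀ j, 0 ≤ Mw j) → (∀ j, 0 ≤ CPw j) → (∀ j, 0 ≤ CQw j) →
        (∀ j (y₁ : X (j + 1)) (y₂ : K j), p j ((T j).symm (y₁, y₂)) ≤ Nw j * (p (j + 1) y₁ + q j y₂)) →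
        (∀ j h, q j (P j h) ≤ CPw j * p j h) → (∀ j h, p (j + 1) (Q j h) ≤ CQw j * p j h) →
        (∀ j, CPw j * Mw j * r j ≤ cw j) → (∀ j, Nw j * cw j < 1) →
        (∀ j, CQw j * Bw j * (Nw j / (1 - Nw j * cw j)) ≤ Bw (j + 1)) →
        (∀ j, CQw j * (Mw j * ((N j : ℝ)⁻¹ - c j)⁻¹ * (Nw j / (1 - Nw j * cw j)) +
          Bw j * (Nw j / (1 - Nw j * cw j) * CPw j * Mw j * ((N j : ℝ)⁻¹ - c j)⁻¹ * (Nw j / (1 - Nw j * cw j)))) ≤ Mw (j + 1)) →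
        -- the second-currency state at level `k`
        (∀ x ∈ closedBall (0 : X k) (r k), ∀ u, p k (Eq' x u) ≤ Bw k * p k u) →
        (∀ x ∈ closedBall (0 : X k) (r k), ∀ x' ∈ closedBall (0 : X k) (r k), ∀ u,
          p k ((Eq' x - Eq' x') u) ≤ Mw k * ‖x - x'‖ * p k u) →
        -- (W1) the fibre letter at every background in the closed chart ball
        (∀ w ∈ closedBall (0 : X (k + 1)) (((N k : ℝ)⁻¹ - c k) * r k), ∀ u, Q k u = 0 →
          p k u ≤ Nw k / (1 - Nw k * cw k) * q k (P k (Eq' (σ w) u))) ∧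
        -- (W2) the response letter off the origin
        (∀ w ∈ ball (0 : X (k + 1)) (((N k : ℝ)⁻¹ - c k) * r k), ∀ v,
          p k (fderiv ℝ σ w v) ≤ Nw k / (1 - Nw k * cw k) * p (k + 1) v) ∧
        -- (W3) the response's second-currency two-point modulus
        (∀ w ∈ ball (0 : X (k + 1)) (((N k : ℝ)⁻¹ - c k) * r k), ∀ w' ∈ ball (0 : X (k + 1)) (((N k : ℝ)⁻¹ - c k) * r k), ∀ v,
          p k ((fderiv ℝ σ w - fderiv ℝ σ w') v) ≤
            Nw k / (1 - Nw k * cw k) * CPw k * Mw k * ((N k : ℝ)⁻¹ - c k)⁻¹ * (Nw k / (1 - Nw k * cw k)) * ‖w - w'‖ *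
              p (k + 1) v) ∧
        -- THE NEXT SECOND-CURRENCY STATE at level `k + 1`
        (∀ w ∈ closedBall (0 : X (k + 1)) (r (k + 1)), ∀ v,
          p (k + 1) ((Q k).comp ((Eq' (σ w)).comp (fderiv ℝ σ w)) v) ≤ Bw (k + 1) * p (k + 1) v) ∧
        (∀ w ∈ closedBall (0 : X (k + 1)) (r (k + 1)), ∀ w' ∈ closedBall (0 : X (k + 1)) (r (k + 1)), ∀ v,
          p (k + 1) (((Q k).comp ((Eq' (σ w)).comp (fderiv ℝ σ w)) - (Q k).comp ((Eq' (σ w')).comp (fderiv ℝ σ w'))) v) ≤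
            Mw (k + 1) * ‖w - w'‖ * p (k + 1) v)) := by
  -- the chart at level `k` reads `(Q_k, P_k ∘ Eq′(0))` on the admissible section `𝒮`
  have hTk : ∀ h, T k h = (Q k h, P k ((Eq' 0) h)) := fun h => by
    rw [hT k 𝒮 h𝒮 hadm h, hlin]; rfl
  -- the smallness SIS consumes (first currency): modulus × radius
  have hck : ∀ x ∈ closedBall (0 : X k) (r k), ‖(P k).comp (Eq' x - Eq' 0)‖ ≤ c k := fun x hx =>
    (SupEquationTowerStep.norm_comp_sub_le_of_modulus_closedBall (P k) (hCP k) (hM0 k) (hr0 k) hM hx).trans (hc k)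
  -- SRSC at level `k` (SIS re-exported inside; the second currency quantified after `σ`)
  obtain ⟨σ, hσ0, ha, hlip, huniq, hb, -, hc0, hcc, hcm, hd, hW⟩ :=
    SupResponseSecondCurrency.inductiveStep_eq_secondCurrency (Q k) (Lp k) (P k) (ι k) (hPι k) (hCP k) hE0 (hr0 k) hE hB
      (hM0 k) hM (Eq' 0) (T k) hTk (hN k) (hcN k) hck
  -- the next radius sits inside the open chart ball, which is non-empty
  have hsub : closedBall (0 : X (k + 1)) (r (k + 1)) ⊆ ball (0 : X (k + 1)) (((N k : ℝ)⁻¹ - c k) * r k) :=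
    closedBall_subset_ball (hr k)
  have h0ball : (0 : X (k + 1)) ∈ ball (0 : X (k + 1)) (((N k : ℝ)⁻¹ - c k) * r k) :=
    mem_ball_self (lt_of_le_of_lt (hr0 (k + 1)) (hr k))
  obtain ⟨-, -, hQD, hPD⟩ := hb 0 h0ball
  refine ⟨σ, hσ0, ha, hlip, huniq, fun w hw => ?_, hd, hc0, fun w hw => (hcc w (hsub hw)).1,
    fun w hw => (hcc w (hsub hw)).2.trans (hBs k),
    fun w hw w' hw' => (hcm w (hsub hw) w' (hsub hw')).trans (mul_le_mul_of_nonneg_right (hMs k) (norm_nonneg _)),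
    ?_, ?_, ?_, ?_⟩
  · obtain ⟨h1, h2, h3, -⟩ := hb w hw
    exact ⟨h1, h2, h3⟩
  · -- the next section: `𝒬_{k+1} ∘ 𝒮 ∘ Dσ(0) = Q_k ∘ (𝒬_k ∘ 𝒮) ∘ Dσ(0) = Q_k ∘ Dσ(0) = 1`
    ext v
    rw [h𝒬 k]
    simp only [ContinuousLinearMap.comp_apply, ContinuousLinearMap.id_apply]
    exact SupEquationTowerStep.comp_section_apply (𝒬 k) 𝒮 (Q k) (fderiv ℝ σ 0) h𝒮 hQD v
  · -- admissibility at every `j < k + 1`: below `k` by the state, at `k` by SIS (b) at `w = 0`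
    intro j hj h
    rcases Nat.lt_succ_iff_lt_or_eq.1 hj with hj' | rfl
    · exact hadm j hj' (fderiv ℝ σ 0 h)
    · have e : Eq' 0 (fderiv ℝ σ 0 h) = 𝒬 j (A₀ (𝒮 (fderiv ℝ σ 0 h))) := by rw [hlin]; rfl
      have h0 := hPD h
      rw [hσ0, e] at h0
      simpa only [ContinuousLinearMap.comp_apply] using h0
  · -- the next linearisation at the origin is the transported one
    rw [hσ0, hlin, h𝒬 k]
    ext v
    rfl
  · -- THE SECOND CURRENCY, after `σ`
    intro p q Nw cw Bw Mw CPw CQw hNw0 hBw0 hMw0 hCPw0 hCQw0 hTw hCPw hCQw hcw hsmallw hBws hMws hBwk hMwk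
    -- the defect SRSC consumes (second currency): modulus × radius
    have hcwk : ∀ x ∈ closedBall (0 : X k) (r k), ∀ u, q k (P k ((Eq' 0 - Eq' x) u)) ≤ cw k * p k u := fun x hx u =>
      (seminorm_defect_le_of_modulus_closedBall (P k) (p k) (q k) (hCPw0 k) (hMw0 k) (hCPw k) hMwk hx u).trans
        (mul_le_mul_of_nonneg_right (hcw k) (apply_nonneg _ _))
    obtain ⟨hW1, hW2, hW3, hW4, hW5⟩ := hW (p k) (p (k + 1)) (q k) (Nw k) (cw k) (Bw k) (Mw k) (CPw k) (CQw k) (hNw0 k)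
      (hBw0 k) (hMw0 k) (hCPw0 k) (hCQw0 k) (hTw k) hBwk hMwk (hCPw k) (hCQw k) hcwk (hsmallw k)
    refine ⟨hW1, hW2, hW3, fun w hw v => ?_, fun w hw w' hw' v => ?_⟩
    · -- the next second-currency bound on `closedBall 0 r_{k+1} ⊆ ball 0 ρ_k`
      have h := hW4 w (hsub hw) v
      simp only [ContinuousLinearMap.comp_apply]
      exact h.trans (mul_le_mul_of_nonneg_right (hBws k) (apply_nonneg _ _))
    · -- the next second-currency modulus
      have h := hW5 w (hsub hw) w' (hsub hw') v
      simp only [sub_apply, ContinuousLinearMap.comp_apply]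
      refine h.trans ?_
      rw [mul_assoc (Mw (k + 1)), mul_assoc (CQw k * _)]
      exact mul_le_mul_of_nonneg_right (hMws k) (mul_nonneg (norm_nonneg _) (apply_nonneg _ _))

/-! ## §3. Toy -/

/-- Toy: the second-currency bound recursion with `C^w_Q = 1`, `B^w_k = 3`, `N^w_k = 2`, `c^w_k = 1∕4` (so `K^w_k = 4`) reads
`B^w_{k+1} ≥ 12` — the letters are DISPLAYED products, nothing is small by itself. -/
example : (1 : ℝ) * 3 * (2 / (1 - 2 * (1 / 4))) = 12 := by norm_num

end Summit.QuantumFields.BalabanUV.T4Continuum.NE7b.SupEquationTowerStepWeighted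

end
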